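import Summits.NavierStokesRegularity.NavierStokesRegularity.Theorems.FilamentSkeletonRssNoExactProfileFreeCommittor
import Summits.NavierStokesRegularity.NavierStokesRegularity.Theorems.FilamentSkeletonRssNoExactProfileGeneralizedMaxPrinciple
import Summits.NavierStokesRegularity.NavierStokesRegularity.Theorems.FilamentSkeletonRssNoExactProfileTestFieldFlux
import Summits.NavierStokesRegularity.NavierStokesRegularity.Theorems.FilamentSkeletonRssKelvinGateRotationSize

/-!
# Route `FilamentSkeletonRss` · negative item `NoExactProfileNearSymmetricPair` (stmt-NavierStokesRegularity-24091) — S_γ groundwork (B4):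
# two consequences of the free committor — a minimum principle at ALL scales for the free scalar adjoint operator, and the AXIAL VORTICITY BALANCE of an exact profile

Helper file (theorems only), `--supports stmt-NavierStokesRegularity-24091 --as helper`; LEAD of 23611 / registrar of 23920, lane ns-filament-21221-p1 g15.

* `freeAdjoint_min_principle` — for EVERY bounded open `D ⊆ ℝ³` (no size restriction) and every rotation rate `α`: a `C²` function `h` with
  `Δh + Dh[½y − αe₃×y] + ½h ≤ 0` on `D` and `h ≥ 0` on `∂D` is `≥ 0` on `D̄`.  (The zeroth-order coefficient `+½` has the «wrong» sign for the plain weak maximum principle;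
  the free committor `ψ(y) = ∫₀¹e^{−t²|y|²/4}dt > 0` is a global solution of the equation — `freeCommittor_pde`, `fderiv_freeCommittor_rot` — so the ground-state transform
  `generalized_min_principle` applies.)  This is the comparison tool for AXIAL components of adjoint fields (`inner_vorticityAdjoint_single_two`, brick (B1)).
* `axial_flux_identity_of_exact_profile` — for an EXACT profile `U` (`E_α(U) + ∇P = 0`, `U ∈ C³` solenoidal, `P ∈ C²`) and any compactly supported cut-off `χ ∈ C²`, with
  `Ψ₀ = ψe₃` and `Ω = curl U`:
  `∫ ⟪(Dχ[v] + Δχ)Ψ₀ + 2DΨ₀[∇χ], Ω⟫ = −∫ χ·(Dψ[U]·⟪e₃,Ω⟫ + ψ·⟪e₃, DU·Ω⟫)`: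
  the ψ-weighted flux of axial vorticity through the cut-off layer equals minus the bulk «transport correction + stretching/tilting production» of axial vorticity
  (`flux_identity_of_exact_profile_testField` ∘ `vorticityAdjoint_freeCommittor`).  This is the (C)-route's starting identity of the design note, with every term a named
  kernel object; B2′ on this route ⇔ exhibiting ONE admissible `χ` for which the right side is provably non-zero.
HONEST FRAMING: groundwork on the NEGATIVE side of a HYPOTHETICAL filament-type rotating-self-similar blow-up route (MODEL rung); 24091/23611/23920 OPEN; nothing here bears on
Navier–Stokes regularity, which is NOT proved.
-/

set_option linter.dupNamespace false

noncomputable section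

namespace Summit.NavierStokesRegularity.NavierStokesRegularity.Theorems.DefectColumnGate

open scoped BigOperators Topology InnerProductSpace Laplacian ContDiff
open Set Function MeasureTheory Metric
open Literature.Analysis.FluidPDE
open Summit.NavierStokesRegularity.NavierStokesRegularity.Theorems.KelvinGate

/-- **MINIMUM PRINCIPLE AT ALL SCALES for the free scalar adjoint operator `Δ + (½y − αe₃×y)·∇ + ½`.**  Let `D ⊆ ℝ³` be bounded and open (any size), `α ∈ ℝ`, and
`h ∈ C²(ℝ³)` with `Δh(y) + Dh(y)[½y − αe₃×y] + ½h(y) ≤ 0` on `D` and `h ≥ 0` on `∂D`.  Then `h ≥ 0` on `D̄`. -/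
theorem freeAdjoint_min_principle (α : ℝ) {D : Set (EuclideanSpace ℝ (Fin 3))} (hD : IsOpen D) (hDb : Bornology.IsBounded D)
    {h : EuclideanSpace ℝ (Fin 3) → ℝ} (hh : ContDiff ℝ 2 h)
    (hsup : ∀ y ∈ D, (Δ h) y + fderiv ℝ h y ((1/2:ℝ) • y - α • cross (EuclideanSpace.single 2 1) y) + (1/2:ℝ) * h y ≤ 0)
    (hbdry : ∀ y ∈ frontier D, 0 ≤ h y) :
    ∀ y ∈ closure D, 0 ≤ h y := by
  -- the drift is bounded on the bounded set `D`
  obtain ⟨R, hR⟩ := hDb.subset_closedBall (0 : EuclideanSpace ℝ (Fin 3))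
  set R' : ℝ := max R 0 with hR'
  have hb : ∀ y ∈ D, ‖(1/2:ℝ) • y - α • cross (EuclideanSpace.single 2 1) y‖ ≤ (1/2 + |α|) * R' := by
    intro y hy
    have hy' : ‖y‖ ≤ R' := le_trans (by simpa using hR hy) (le_max_left _ _)
    have hrot : ‖cross (EuclideanSpace.single 2 1) y‖ ≤ ‖y‖ := norm_cross_single_two_le y
    calc ‖(1/2:ℝ) • y - α • cross (EuclideanSpace.single 2 1) y‖
        ≤ ‖(1/2:ℝ) • y‖ + ‖α • cross (EuclideanSpace.single 2 1) y‖ := norm_sub_le _ _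
      _ ≤ (1/2:ℝ) * R' + |α| * R' := by
          rw [norm_smul, norm_smul, Real.norm_eq_abs, Real.norm_eq_abs, abs_of_pos (by norm_num : (0:ℝ) < 1/2)]
          exact add_le_add (mul_le_mul_of_nonneg_left hy' (by norm_num)) (mul_le_mul_of_nonneg_left (hrot.trans hy') (abs_nonneg α))
      _ = (1/2 + |α|) * R' := by ring
  have hc : ∀ y ∈ D, |(fun _ : EuclideanSpace ℝ (Fin 3) => (1/2:ℝ)) y| ≤ 1/2 := fun y _ => by simp only [abs_of_pos (by norm_num : (0:ℝ) < 1/2)]; rfl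
  -- the committor is a positive global solution
  have hψ := contDiff_two_freeCommittor
  have hψsup : ∀ y ∈ D, (Δ (fun z : EuclideanSpace ℝ (Fin 3) => ∫ t in (0:ℝ)..1, Real.exp (-(t ^ 2 * ‖z‖ ^ 2 / 4)))) y
      + fderiv ℝ (fun z : EuclideanSpace ℝ (Fin 3) => ∫ t in (0:ℝ)..1, Real.exp (-(t ^ 2 * ‖z‖ ^ 2 / 4))) y ((1/2:ℝ) • y - α • cross (EuclideanSpace.single 2 1) y)
      + (fun _ : EuclideanSpace ℝ (Fin 3) => (1/2:ℝ)) y * (∫ t in (0:ℝ)..1, Real.exp (-(t ^ 2 * ‖y‖ ^ 2 / 4))) ≤ 0 := by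
    intro y _
    have h1 := freeCommittor_pde y
    have h2 := fderiv_freeCommittor_rot y
    rw [map_sub, map_smul, map_smul, h2, smul_zero, sub_zero, smul_eq_mul]
    simp only
    linarith
  have he : ‖(EuclideanSpace.single 2 (1:ℝ) : EuclideanSpace ℝ (Fin 3))‖ = 1 := by
    rw [PiLp.norm_single, norm_one]
  exact generalized_min_principle hD hDb he hψ freeCommittor_pos hh (c := fun _ => (1/2:ℝ)) hb hc hψsup hsup hbdry

/-- **AXIAL VORTICITY BALANCE OF AN EXACT PROFILE.**  Let `U ∈ C³` be solenoidal with `E_α(U) + ∇P = 0` pointwise (`P ∈ C²`), `χ ∈ C²` compactly supported, and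
`Ψ₀ = ψe₃` the free committor (hypothesis `hΨ₀`).  Then
`∫ ⟪(Dχ[U + ½y − αe₃×y] + Δχ)Ψ₀ + 2DΨ₀[∇χ], curl U⟫ = −∫ χ·(Dψ[U]·⟪e₃, curl U⟫ + ψ·⟪e₃, DU(curl U)⟫)`. -/
theorem axial_flux_identity_of_exact_profile (α : ℝ) {U : EuclideanSpace ℝ (Fin 3) → EuclideanSpace ℝ (Fin 3)} {P χ : EuclideanSpace ℝ (Fin 3) → ℝ}
    (hU : ContDiff ℝ 3 U) (hdiv : VectorCalculus.IsDivFree U) (hP : ContDiff ℝ 2 P)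
    (hprof : ∀ y, lerayOp α U y + gradient P y = 0) (hχ : ContDiff ℝ 2 χ) (hχc : HasCompactSupport χ)
    {Ψ₀ : EuclideanSpace ℝ (Fin 3) → EuclideanSpace ℝ (Fin 3)}
    (hΨ₀ : Ψ₀ = fun z => (∫ t in (0:ℝ)..1, Real.exp (-(t ^ 2 * ‖z‖ ^ 2 / 4))) • (EuclideanSpace.single 2 (1:ℝ) : EuclideanSpace ℝ (Fin 3))) :
    ∫ y, ⟪(fderiv ℝ χ y (U y + (1/2:ℝ) • y - α • cross (EuclideanSpace.single 2 1) y) + (Δ χ) y) • Ψ₀ y + (2:ℝ) • fderiv ℝ Ψ₀ y (gradient χ y), curl U y⟫_ℝ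
      = -∫ y, χ y * (fderiv ℝ (fun z : EuclideanSpace ℝ (Fin 3) => ∫ t in (0:ℝ)..1, Real.exp (-(t ^ 2 * ‖z‖ ^ 2 / 4))) y (U y)
            * ⟪(EuclideanSpace.single 2 (1:ℝ) : EuclideanSpace ℝ (Fin 3)), curl U y⟫_ℝ
          + (∫ t in (0:ℝ)..1, Real.exp (-(t ^ 2 * ‖y‖ ^ 2 / 4))) * ⟪(EuclideanSpace.single 2 (1:ℝ) : EuclideanSpace ℝ (Fin 3)), fderiv ℝ U y (curl U y)⟫_ℝ) := by
  set ψ : EuclideanSpace ℝ (Fin 3) → ℝ := fun z => ∫ t in (0:ℝ)..1, Real.exp (-(t ^ 2 * ‖z‖ ^ 2 / 4)) with hψ_def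
  have hψ : ContDiff ℝ 2 ψ := contDiff_two_freeCommittor
  have hΨ : ContDiff ℝ 2 Ψ₀ := by rw [hΨ₀]; exact contDiff_two_freeCommittor_smul_e3
  have hI := flux_identity_of_exact_profile_testField α hU hdiv hP hprof hΨ hχ hχc
  rw [hI, ← integral_neg]
  refine integral_congr_ae (Filter.Eventually.of_forall fun y => ?_)
  have hres := vorticityAdjoint_freeCommittor α U hΨ₀ y
  have hD : fderiv ℝ Ψ₀ y (U y) = (fderiv ℝ ψ y (U y)) • (EuclideanSpace.single 2 (1:ℝ) : EuclideanSpace ℝ (Fin 3)) := by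
    rw [hΨ₀, (((hψ.differentiable (by norm_num)) y).hasFDerivAt.smul_const (EuclideanSpace.single 2 (1:ℝ) : EuclideanSpace ℝ (Fin 3))).fderiv,
      ContinuousLinearMap.smulRight_apply]
  have hΨy : Ψ₀ y = ψ y • (EuclideanSpace.single 2 (1:ℝ) : EuclideanSpace ℝ (Fin 3)) := by rw [hΨ₀]
  simp only
  rw [hres, hD, hΨy, inner_sub_left, inner_neg_left, inner_smul_left, ContinuousLinearMap.adjoint_inner_left, inner_smul_left, RCLike.conj_to_real,
    RCLike.conj_to_real]
  ring

end Summit.NavierStokesRegularity.NavierStokesRegularity.Theorems.DefectColumnGate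

end
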